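import Summits.Ventures.CertifiedManyBodySolver.Theses.CovNdNiO2M22
import Summits.Ventures.CertifiedManyBodySolver.Observables.RungLeavesCoverageNdNiO2M22ResidualBundlesCut
import Summits.Ventures.CertifiedManyBodySolver.Certificates.HubbardSquare_NdBoxE_station5_afChordCaps_M22
import Summits.Ventures.CertifiedManyBodySolver.Certificates.HubbardSquare_NdBoxE_n409o500_pairBP_j320777
import Summits.Ventures.CertifiedManyBodySolver.Certificates.HubbardSquare_NdBoxE_n409o500_pairCP_j320839
import HarnessLib
import HarnessLib.Audit

/-!
# Ventures/CertifiedManyBodySolver — Theorems/CovNdNiO2M22ResidualLowUSlab22.lean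

HONEST FRAMING: the route item `Theses.CovNdNiO2M22.ResidualLowUSlab22` (stmt-Ventures-23945, route-Ventures-CovNdNiO2M22; `U ∈ [5, 110/21]`,
`t′ ∈ [−23/50, −11/25]`, `n ∈ [393/500, 409/500]`, bar `4418857/10⁷`) **CLOSED MODULO CLAIM NODES** — ONE `exact` on hubbard-cov-ndnio2-unc-3's parametric
closer `ndM22_residualLowSliver_of_PbundleRowsWN_capTables` (p679006, `Observables/RungLeavesCoverageNdNiO2M22ResidualBundlesCut.lean`) fed with the TWO
segment P = −X₀(−23/50) BUNDLE ROWS at anchor `409/500`, each obtained AS A THEOREM (kernel t′-pair law p662147, `TPrimePinnedPairRowWN.bundleWN_vertex` for both rows — the hub vertex binds) of ONE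
`@[conjecture]` PINNED-PAIR claim node typed by hubbard-cov-ndnio2-box-1 straight from two exact-rational SDP dual certificates (hub ⊕ pinned spoke): segment B
`[−11/20, −23/50]` (used on `[−529/1100, −23/50]`) = `cert_ndBoxE_n409o500_pairBP_om23o50_j320777` (hub H2 j316629 ⊕ spoke S2 j320777; p692258; row word 0.4251752) and
segment C `[−23/50, −11/25]` = `cert_ndBoxE_n409o500_pairCP_om23o50_j320839` (hub H3 j316631 ⊕ spoke S3 j320839; p694694; row word 0.4173548). The `Q = −X₀(−11/25)` slots
are the KINEMATIC (state-free, hypothesis-free) theorem `ndM22_QRowWN_kinematic` (p663366, from p636407; price 0.4418570, margin 287/10⁷) inside the closer; cap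
tables = hubbard-cov-ndnio2-unc-1's node-free station-5 chord cap `ndBoxE_station5_afChordCap_segBC_m22_q` (−7921515759/10¹⁰, p662195) for both rows — NO cap node;
floors node-free (band bottom, `ndM22_station5_rectFloors`); every remaining side condition is a `norm_num` fact on the nodes' literals (segment ends, `lo ≤ floor`,
`C ≤ hi`, three END PRICES per row ≤ the bar). The item does NOT close `proved` while the nodes are claims (route-pen protocol (α′): HELD «closed modulo nodes»; this
file is filed `--supports`, never `--by`). One-sided certified stiffness CEILINGS on a SCREENING-GRADE downfolded box «Nd₀.₈Sr₀.₂NiO₂ (M22): residual = INFL-dop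
filling-padding band above the determination hull» = CONTROL / CALIBRATION (class (xx1)) + labelled heuristic; a ceiling never speaks to the presence or absence
of superconductivity; no `T_c` / pairing / phase sentence; never «certified true negative / positive»; no rung leaf or summit statement is proved here. Seat
`hubbard-cov-ndnio2-unc-3` (g6); zero compute.
NUMBERS: common ceiling `c := 4418857/10⁷` = the item's bar (every end price is tested against the bar itself); P-row words (7-dp UP; = the largest of the three end
prices since both density slopes are negative) B 0.4251752 (margin 0.0167105) / C 0.4173548 (margin 0.0245309); kinematic Q price 0.4418570 (margin 0.0000287).
References: T. Koma, H. Tasaki, J. Stat. Phys. 76 (1994) 745, §1 [KomaTasaki1994]; D. J. Scalapino, S. R. White, S.-C. Zhang, PRB 47 (1993) 7995, §II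
[ScalapinoWhiteZhang1993].
-/

noncomputable section

namespace Summit.Ventures.CertifiedManyBodySolver.Theorems

open Summit.Ventures.CertifiedManyBodySolver.Observables Summit.Ventures.CertifiedManyBodySolver.Certificates
open Summit.Ventures.CertifiedManyBodySolver.Downfold
open Literature.MathematicalPhysics.QuantumLattice Literature.MathematicalPhysics.QuantumLattice.ThermodynamicLimit

/-- **`ResidualLowUSlab22` CLOSED MODULO NODES** (pair-node edition, AF cap key; `c :=` the bar `4418857/10⁷`): the two pinned-pair claim nodes (B p692258, C p694694) ⇒
their segment P bundle rows by the kernel t′-pair law ⇒ with the kinematic Q rows, the node-free cap/floor tables and decidable end prices, the route decl, by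
`ndM22_residualLowSliver_of_PbundleRowsWN_capTables`. [cite: KomaTasaki1994, §1] [cite: ScalapinoWhiteZhang1993, §II] -/
theorem covNdNiO2M22_ResidualLowUSlab22_of_pairNodes_AF
    (hB : cert_ndBoxE_n409o500_pairBP_om23o50_j320777)
    (hC : cert_ndBoxE_n409o500_pairCP_om23o50_j320839) :
    Summit.Ventures.CertifiedManyBodySolver.Theses.CovNdNiO2M22.ResidualLowUSlab22 := by
  unfold Summit.Ventures.CertifiedManyBodySolver.Theses.CovNdNiO2M22.ResidualLowUSlab22
  exact ndM22_residualLowSliver_of_PbundleRowsWN_capTables (c := 4418857 / 10000000)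
    (ndBoxE_n409o500_bundleB_om23o50_AF_j320777_rowWN_of_pair hB)
    (ndBoxE_n409o500_bundleC_om23o50_AF_j320839_rowWN_of_pair hC)
    (by norm_num) (by norm_num) (by norm_num) (by norm_num)
    ndBoxE_station5_afChordCap_segBC_m22_q ndBoxE_station5_afChordCap_segBC_m22_q
    (by norm_num) (by norm_num) (by norm_num) (by norm_num)
    (by norm_num) (by norm_num) (by norm_num) (by norm_num)
    (by norm_num) (by norm_num)
    (by norm_num) (by norm_num)
    ⟨by norm_num, by norm_num, by norm_num⟩ ⟨by norm_num, by norm_num, by norm_num⟩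
    (by norm_num)

end Summit.Ventures.CertifiedManyBodySolver.Theorems

end
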